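import Mathlib
import HarnessLib
import HarnessLib.Audit
import Summits.QuantumFields.Statement
import Summits.QuantumFields.YangMills.Theses.InfiniteVolumeContinuum
import Summits.QuantumFields.YangMills.Theses.OnsetCalibration
import Summits.QuantumFields.YangMills.Theses.TypicalExteriorCeilings

/-!
Route: SquareRootCeilings

DORMANT since 2026-09-02T22:25:41Z (reconciler: no traction for 5 d (last activity statement-attached at 2026-08-28T21:36:46Z); parked, not closed — `ledger route dormant route-QuantumFields-SquareRootCeilings --off` to reactivate) — unstaffed, not closed; items shared with open routes are served there. `ledger route dormant <id> --off` reactivates.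

# Route SquareRootCeilings — square-root Gaussian domination makes the two-point ceiling the only
ceiling the leaf owes

LINE (D-0145 ideator ym-idea-11 g3, lens «wuc» = weakest unknown consequence; bears_on R2a-IV = leaf
`InfiniteVolumeContinuum.HypercubicOSDataFromInfiniteVolume`, stmt-QuantumFields-19868; class rung;
no summit is proved by a line).
It suffices to show X = SqrtDomination ∧ SubOnsetTwoPointCeilings (∧ the shared residual OnsetFloors
of route OnsetCalibration, by name):
(K2, the lever) SQUARE-ROOT DOMINATION — on every odd torus at every large β the centred n-point
moment of pairwise-separated
single-plane plaquette fields is at most (C n^θ)ⁿ · ∏ᵢ √(bᵢ) whenever |Cov(Pᵢ,Pⱼ)| ≤ bᵢ for all j ≠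
i: each insertion pays the square
root of its best two-point covariance — the cycle (Wick) structure of a bilinear composite of a
Gaussian field, asserted
non-perturbatively and WITHOUT any unit, window, sign or size claim; (K1, the wuc) the n = 2
instance of the sub-onset hyperscaling ceiling,
|Cov(P_x,P_y)| ≤ (C/R⁴)² in the femto window below the onset of the floors. K1 × K2 give the
factorial-tolerant sub-onset ceilings
(support DominationTransfer, provable now), which the shared support
`TypicalExteriorCeilings.FactorialCalibration`
(stmt-QuantumFields-25894, by name) turns, with OnsetFloors (stmt-QuantumFields-23314, by name) and
the PROVED OnsetVanishes
(stmt-QuantumFields-23315, `onsetVanishes_proof`, used inside the Assembly item), into the leaf.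
Lean: `SqrtDomination ∧ SubOnsetTwoPointCeilings ∧
Summit.QuantumFields.YangMills.Theses.OnsetCalibration.OnsetFloors`

## Assembly
`closes (hA : Assembly) (hD : SqrtDomination) (hT : SubOnsetTwoPointCeilings) (hX :
DominationTransfer) (hC : FactorialCalibrationC)
(hF : OnsetFloorsC) : leaf := hA hD hT hX hC hF` — every binder consumed. The Assembly item itself
is provable NOW (checked sorry-free in
the seat Sketch.lean as `assembly_now`): `fun hD hT hX hC hF => hC (hX hT hD) hF
OnsetCalibration.onsetVanishes_proof` — modus ponens over
the two supports and the landed `Theorems.OnsetCalibration.onsetVanishes_proof`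
(stmt-QuantumFields-23315, proved). The open content is
exactly K2 (new) + K1 (the n = 2 wall) + the shared NT-lite residual OnsetFloors.

CLOSES_TARGET: closes rung R2a of QuantumFields: Summit.QuantumFields.YangMills.Theses.InfiniteVolumeContinuum.HypercubicOSDataFromInfiniteVolume (D-0061; not the summit Statement) — the deciding theorem of this route concludes that registered leaf instead of the Statement decl `YangMills` (class rung: servable and labelled, never counted as concluding the summit Statement).

Rationale: WHY THIS LINE. Every ceilings currency on LADDER-YM is stated and attacked UNIFORMLY IN THE ORDER n
— FBL6/MomentBounds6 of the spine
(InfiniteVolumeContinuum via BalabanLadder UV ∧ UVSeamRec), SubOnsetCeilings of OnsetCalibration,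
the annealed L^p boundary law of
TypicalExteriorCeilings, the good-exterior law + rarity suppliers of the UVSeamRec defect collar —
and the n-dependence is always
manufactured by a conditioning (DLR-collar) argument. This line SPLITS ORDER FROM SIZE: size is
claimed only at n = 2 (K1, the weakest
unknown pointwise ceiling that still feeds the leaf) and every higher order is reduced to it by a
structural correlation inequality
(K2) of the kind Newman derived from the Lee–Yang property for even ferromagnets
[Newman1975Gaussian, Newman1975, Lebowitz1974,
Shlosman1986; GlimmJaffe1987 ch. 4], i.e. an import from correlation inequalities / zeros of
partition functions [LeeYang1952,
Barvinok2016], where "zero-free ⇒ every cumulant is dominated by the variance" is the standard move;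
Lee–Yang is known for ℤ₂ lattice
gauge theory (Dunlop 1980, [GlimmJaffe1987 §4.5 Remark 5]) and open for other gauge groups. K2 is
scale-covariant (exponent ½ per
insertion, O(1) constant), so unlike the bubble-small tree bounds behind φ⁴₄ triviality it forces no
Gaussianity (NG stays possible),
and OS E0′ tolerates the (n^θ)ⁿ ≤ e^(θn)(n!)^θ loss [OsterwalderSchrader1975,
KravchukQiaoRychkov2021]. Negatives index (7 entries)
untouched: no positivity of covariances (GluonFreeDual / ToronPlaneAnticorrelation) is used — K2
sees |Cov| only.

RANKED CRUXES. #2 SqrtDomination (crux) — for SU(2)-class G and every lattice representation r there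
are C, θ ≥ 0 and β₄ such that for β ≥ β₄, every odd torus (ℤ/(2L+1))⁴ with 4R+8 ≤ L (1 ≤ R), every n
≥ 2 single-plane plaquette fields Pᵢ = plane (q i) (x i) at sites pairwise cyclically
(2R+4)-separated in some coordinate, and every b ≥ 0 with |Cov_T(Pᵢ,Pⱼ)| ≤ bᵢ for all j ≠ i: |E_T ∏ᵢ
(Pᵢ − E_T Pᵢ)| ≤ (C n^θ)ⁿ ∏ᵢ √bᵢ. No unit, window, decay or sign is asserted — only domination of
every order by the two-point function (square root = scale-covariant Wick/cycle structure).
[difficulty: open-problem] (why it might fail: an insertion whose covariances with all others cross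
zero in β (complementary-plane pairs vanish at leading order; toron anticorrelation shows signs
move) while the joint moment does not vanish to matching order; or heavy large-field tails at fixed
variance.) [Newman1975Gaussian, Newman1975, Lebowitz1974, Shlosman1986, GlimmJaffe1987,
arXiv:1803.01950]
#3 SubOnsetTwoPointCeilings (crux) — the n = 2 instance of the sub-onset ceilings (wuc): for
SU(2)-class G, r, calibrating tests (v; f,g,h) and Λ₅ there is ε₀ > 0 such that for every 0 < ε ≤ ε₀
carrying onset-floor data there are C ≥ 0, ℓ₄ > 0, β₄ with: at every β ≥ β₄ and every resolution s ∈
(0,1] below the onset (no floors at any s' ∈ [2s,1]), on every odd torus with 4R+8 ≤ L, for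
plaquette fields of orientations q, q' at sites cyclically (2R+4)-separated, 1 ≤ R, R s ≤ ℓ₄:
|Cov_T(P_q(x), P_q'(y))| ≤ (C/R⁴)². Strictly weaker than SubOnsetCeilings (stmt-QuantumFields-23313)
and than the antecedent of FactorialCalibration (both uniform in n). [difficulty: open-problem] (why
it might fail: it is the n = 2 hyperscaling (E0′-class) bound at weak coupling, unprinted in d = 4:
a sub-onset resolution may sit in a crossover where |Cov| at lattice separation R exceeds C/R⁸ by
factors not uniform in β.) [arXiv:1803.01950, Balaban1989CMP122, OsterwalderSeiler1978,
OsterwalderSchrader1975]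
#4 OnsetFloorsC (crux) — the onset-floor datum of route OnsetCalibration BY NAME
(stmt-QuantumFields-23314; shared NT-lite residual, landed `OnsetCalibration.onsetFloors_of_NT :
BalabanLadder.NT → OnsetFloors`): for SU(2)-class G some r and tests (v; f,g,h pairwise disjoint)
with ε > 0, Λ₅, β₅ such that every β ≥ β₅ has a resolution s ∈ (0,1] carrying both floors on all
large odd tori. [difficulty: open-problem] (why it might fail: it contains two- and three-point
non-triviality for SU(2) (the ladder's NT residual): the rescaled truncated functions could vanish
at every resolution (triviality scenario) or floors could hold only on L-dependent windows.)
[arXiv:1803.01950, Balaban1989CMP122, OsterwalderSeiler1978]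
#9 DominationTransfer (support) — K1 → K2 → the factorial-tolerant sub-onset ceilings, VERBATIM the
antecedent of `TypicalExteriorCeilings.FactorialCalibration`: take ε₀, C₁, ℓ₄, β₄ from K1 and C, θ,
β₄' from K2 (β₄ := max); for n ≥ 2 put bᵢ := (C₁/R⁴)² (K1 on each separated pair), so |E∏| ≤ (C
n^θ)ⁿ (C₁/R⁴)ⁿ = (C·C₁·n^θ/R⁴)ⁿ with κ := θ; n = 0 (empty product, 1 ≤ 1) and n = 1 (centred mean =
0, torus Gibbs state a probability measure) are trivial. Pure algebra plus integral linearity;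
provable now. [difficulty: provable-now] [OsterwalderSchrader1975]
#9 FactorialCalibrationC (support) — BY NAME the shared support
`TypicalExteriorCeilings.FactorialCalibration` (stmt-QuantumFields-25894): factorial-tolerant
sub-onset ceilings → OnsetFloors → OnsetVanishes → the leaf (the OnsetCalibration calibration
`assembly_proof` re-run with the factorial-tolerant infinite-volume engine `IVData_holds`, K ↦ C
n^κ). [difficulty: L] [OsterwalderSchrader1975, KravchukQiaoRychkov2021, GlimmJaffe1987]

TWO-LAYER PLAN. SqrtDomination ⇐ CumulantCycleDomination (joint cumulants of separated plane fields
≤ (C n^θ)ⁿ × the best cyclic product of √|Cov|)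
→ MomentsFromCumulants (partition bookkeeping, (n!)-tolerant) → SqrtDomination; and, mechanism side,
CumulantCycleDomination ⇐
LocalLeeYang (β-uniform zero-freeness of E_T exp(Σ tᵢ Pᵢ) in a complex polydisc of the local
couplings tᵢ) → NewmanTransfer
(zero-free ⇒ Gaussian domination, Newman-1975 shape). Nothing of this is filed now.

KILL CRITERIA. A theorem exhibiting, for SU(2), arbitrarily large β and separated configurations
whose centred moments exceed (C n^θ)ⁿ ∏√(max |Cov|)
for every C, θ (e.g. an insertion decorrelated from all others at the two-point level with a
non-vanishing joint moment) closes the route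
`refuted:SqrtDomination`; a refutation of SubOnsetTwoPointCeilings (two-point hyperscaling fails
below onset) kills this line AND the
n = 2 case of OnsetCalibration / TypicalExteriorCeilings — pivot to a smeared two-point currency;
OnsetFloors refuted ⇒ re-point the
floors residual to BalabanLadder.NT by name. If BalabanLadder.UV ∧ UVSeamRec close,
InfiniteVolumeContinuum closes the same leaf and
this route is superseded.

NOT DECOMPOSED YET. The cumulant form of K2, the moments-from-cumulants bookkeeping, the
Lee–Yang/Newman mechanism (polydisc zero-freeness of the locally
modulated torus partition function) and the large-field tail control at fixed variance are layer-2
children; θ (expected 1, from the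
(n−1)!/2 cycle count) is left existential; no interface object is posited.

CHEAPEST FALSIFIER. n = 3 with one insertion in a plane complementary to the other two (q₁ = (0,1)
at x₁; q₂ = q₃ = (2,3)): at leading lattice
perturbation theory Cov(P₁,P₂) = 2⟨F₀₁F₂₃⟩² ≡ 0, so K2 demands that the joint third moment be as
small as the NEXT-order covariance to
the power ½ — a two-loop lattice-PT check (instrument row: «LPT-2loop mixed-orientation κ₃ vs √Cov,
SU(2) Wilson, separations 2..6»),
or a small odd-torus evaluation at moderate β (instrument row: «odd torus L = 13 Monte-Carlo κ₃ /
∏√|Cov| scan, β ∈ [2.2, 2.8]»,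
calibration only, kit not allowed on this seat). In Lean: at leading order K2 is the cycle identity
for bilinear composites of
Gaussian vectors (BC5 plan-only rung `stub_gaussianCycleDomination`).

NUMBERS. E0′ target ‖Sₙ F‖ ≤ α (n!)^β ‖F‖_(ns) [OsterwalderSchrader1975]; engine output ‖T n q F‖ ≤
5 Kⁿ ‖F‖_(10n) (IVData_holds) becomes
5 (C e^θ)ⁿ (n!)^θ ‖F‖_(10n) under (C n^θ)ⁿ ceilings; expected θ = 1 (cycle count (n−1)!/2 ≤ nⁿ); K1
exponent 8 = 2 × dim F².

DEFINITION REQUESTS. None: every item is typed over `DlrCollarTransfer.torusE / plane / Q2 / Q3`,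
`thetaTest`, `ZMod.valMinAbs` and the OnsetCalibration /
TypicalExteriorCeilings decls (by name).

Novelty: Searches (2026-08-28): lit search --hybrid "Gaussian correlation inequalities Lee-Yang Ursell
functions Newman" (8: [corpus:book:glimm1987-quantum-physics-functional-integral-point-view-2nd
p.56–69], [corpus:book:friedli2017 p.134, p.147]); lit search --hybrid "truncated correlation
functions bounded by products of two-point functions tree graph inequality" (8:
[corpus:salmhofer1999 p.78], [corpus:rivasseau1991 p.151], glimm1987 p.56); lit vsearch "higher
cumulants dominated by products of square roots of two-point covariances" (8; nearest
[corpus:rivasseau1991 p.288], cluster-expansion tree bounds, massive regime only); lit search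
--hybrid "plaquette plaquette correlation lattice gauge theory weak coupling decay bound" (8:
[corpus:montvay1994 p.160–162], [corpus:creutz2022 p.58] — numerics / strong coupling); lit galaxy
search "Gaussian inequality|Lebowitz inequality|Ursell function" --star all (20:
[galaxy:panama:518952308441153] Glimm–Jaffe Collected Papers, [galaxy:panama:296859549565014]
Ruelle, [galaxy:panama:359188114964507] Friedli–Velenik; no gauge-theory hit); lit galaxy search
"plaquette-plaquette|plaquette correlation" --star all (19, textbooks only); lit galaxy search
"Fisher zeros|Lee-Yang zeros|partition function zeros" --star pdf (10: [galaxy:pdf:2209674360]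
Bencs–Davies–Patel–Regts zero-free regions, [galaxy:pdf:7536062899445022120] Shamis–Zeitouni; none
for 4-d Yang–Mills); no hits for "square-root domination plaquette cumulants" / "Gaussian domination
latti  [refs: book:glimm1987-quantum-physics-functional-integral-point-view-2nd, book:friedli2017]

Barriers (technique_class: correlation-inequalities, gaussian-domination, lee-yang): - technique_class: correlation-inequalities, gaussian-domination, lee-yang
- Literature.Barriers.QuantumFields.AbelianDeconfinementD4: outside its conclusion class — the
group-blindness barrier (`GroupBlindIrrepAreaLawD4` / `GroupBlindClusteringD4` refuted from U(1)₄
deconfinement, Guth 1980 / Fröhlich–Spencer 1982) blocks CONFINEMENT and EXPONENTIAL CLUSTERING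
conclusions drawn for every compact G; this line concludes only UV-side E0′ moment ceilings /
domination (rung R2a-IV), makes no area-law, string-tension or clustering-rate claim, and K2/K1 are
stated for the SU(2) class only — their abelian analogues are expected TRUE (Gaussian-exact in the
U(1)₄ Coulomb phase), so group-blindness of a correlation-inequality proof would cost nothing here.
- Literature.Barriers.QuantumFields.ToronPlaneAnticorrelation: outside its class — K2 uses |Cov| and
asserts no sign, no association and no product-closed single-factor criterion; the barrier's
witnesses (one-site / 2⁴ tori, small β) are excluded by β ≥ β₄ and 4R+8 ≤ L, but they flag the real
risk (zero crossings of complementary-plane covariances), recorded as K2's why-it-might-fail.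
- Literature.Barriers.QuantumFields.ScalarPhi4Triviality: outside — K2 dominates with an O(1)
constant and exponent ½ per insertion (scale-covariant); it is not the bubble-small tree bound of d
≥ 4 φ⁴ and forces no Gaussianity (κ₃ ≠ 0 allowed, NG compatible); nothing is constructed as a φ⁴
lattice limit.
- Literature.Barriers.QuantumFields.UVStabilityNo

History (route lifecycle, newest last):
- 2026-08-28T08:05:38Z · rev 2: restated SqrtDomination (stmt-QuantumFields-26670) — repair per idea-crit-9 VERDICT #20 K-class warning (not a strike): b is now ONE uniform bound for ALL (2R+4)-separated single-plane pairs on the torus (it major (planner-ym-idea-11-g3-0)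
- 2026-08-28T08:26:22Z · rev 3: informal re-worded for SqrtDomination (planner-ym-idea-11-g3-0)
- 2026-09-02T22:25:41Z · DORMANT — reconciler: no traction for 5 d (last activity statement-attached at 2026-08-28T21:36:46Z); parked, not closed — `ledger route dormant route-QuantumFields-Squar (operator:999:1132451)

sub-problem: YangMills · status: dormant · opened planner-ym-idea-11-g3-0 2026-08-28T07:36:04Z · rev 3 · ledger route-QuantumFields-SquareRootCeilings
GENERATED by the gate from the ledger (D-0016/17). Provers cite these decls: `theorem foo : Summit.QuantumFields.YangMills.Theses.SquareRootCeilings.<Decl> := …` in Summits/QuantumFields/YangMills/Theorems/<Name>.lean.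
-/

namespace Summit.QuantumFields.YangMills.Theses.SquareRootCeilings

open scoped BigOperators Topology Manifold Classical MeasureTheory ProbabilityTheory Matrix InnerProductSpace ComplexConjugate ContinuousMap
open Filter Set Function TopologicalSpace MeasureTheory

attribute [summit_statement] _root_.YangMills
attribute [summit_statement] _root_.Summit.QuantumFields.YangMills.Theses.InfiniteVolumeContinuum.HypercubicOSDataFromInfiniteVolume

-- earlier SqrtDomination (stmt-QuantumFields-26670, replaced 2026-08-28T08:05:38Z -> stmt-QuantumFields-26902): retired by None — open Literature.MathematicalPhysics.QuantumFieldTheory Literature.MathematicalPhysics.QuantumLattice Summit.QuantumFields.YangMills.Cruxes.OSLegsFromFemtoAndGap.DlrCollarTransfer in ∀ (G : Type) [Group G] [TopologicalSpace G] [IsTopologicalGroup G] [CompactSpace G], IsCom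
/-- item stmt-QuantumFields-26902 · crux · rank 2 · open · by planner
why it might fail: Mixed-orientation insertion sets whose joint moments decay slower than b^(n/2) in the crossover even for the uniform envelope b (no Wick/cycle structure survives strong fields), or heavy large-field tails at fixed covariance scale forcing θ unbounded; no SU(2) correlation-inequality tool exists.
sources: Newman1975Gaussian, arXiv:1803.01950
[crux] for SU(2)-class G and every lattice representation r there are C, θ ≥ 0 and β₄ such that for
β ≥ β₄, every odd torus (ℤ/(2L+1))⁴ with 4R+8 ≤ L (1 ≤ R) and every b ≥ 0 that bounds |Cov_T(P_q(x),
P_q′(y))| for ALL single-plane pairs cyclically (2R+4)-separated in some coordinate (ONE uniform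
envelope — it majorises the same-plane on-axis mirror covariances, > 0 by reflection positivity, so
it cannot vanish at an isolated zero crossing; rev 2 per idea-crit-9 #20): for every n ≥ 2 and
single-plane plaquette fields Pᵢ = plane (q i) (x i) at sites pairwise cyclically (2R+4)-separated,
|E_T ∏ᵢ (Pᵢ − E_T Pᵢ)| ≤ (C n^θ √b)ⁿ. No unit, window, decay or sign is asserted — only domination
of every order by the two-point envelope (square root = scale-covariant Wick/cycle structure;
free-field shadow landed: Theorems/SquareRootCeilingsGaussianCycleRung). [difficulty: open-problem] -/
@[route_item "route-QuantumFields-SquareRootCeilings"]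
def SqrtDomination : Prop :=
  open Literature.MathematicalPhysics.QuantumFieldTheory Literature.MathematicalPhysics.QuantumLattice Summit.QuantumFields.YangMills.Cruxes.OSLegsFromFemtoAndGap.DlrCollarTransfer in ∀ (G : Type) [Group G] [TopologicalSpace G] [IsTopologicalGroup G] [CompactSpace G], IsCompactSimpleLieGroup G → Nonempty (G ≃ₜ* Matrix.specialUnitaryGroup (Fin 2) ℂ) → letI : MeasurableSpace G := borel G; haveI : BorelSpace G := ⟨rfl⟩; ∀ (r : LatticeRep G), ∃ (C θ β₄ : ℝ), 0 ≤ C ∧ 0 ≤ θ ∧ ∀ β : ℝ, β₄ ≤ β → ∀ (L R : ℕ) (b : ℝ), 1 ≤ R → 4 * R + 8 ≤ L → 0 ≤ b → (∀ (q q' : Fin 4 × Fin 4) (x y : Fin 4 → ℤ), q.1 < q.2 → q'.1 < q'.2 → (∃ k : Fin 4, (2 * (R : ℤ) + 4) ≤ |((((x k - y k : ℤ) : ZMod (2 * L + 1))).valMinAbs : ℤ)|) → |torusE G r β L (fun U => (plane G r q x U - torusE G r β L (plane G r q x)) * (plane G r q' y U - torusE G r β L (plane G r q' y)))| ≤ b)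 → ∀ (n : ℕ) (q : Fin n → Fin 4 × Fin 4) (x : Fin n → (Fin 4 → ℤ)), (∀ i, (q i).1 < (q i).2) → 2 ≤ n → (∀ i j : Fin n, i ≠ j → ∃ k : Fin 4, (2 * (R : ℤ) + 4) ≤ |((((x i k - x j k : ℤ) : ZMod (2 * L + 1))).valMinAbs : ℤ)|) → |torusE G r β L (fun U => ∏ i, (plane G r (q i) (x i) U - torusE G r β L (plane G r (q i) (x i))))| ≤ (C * (n : ℝ) ^ θ * Real.sqrt b) ^ n

/-- item stmt-QuantumFields-26671 · crux · rank 3 · SPLIT (gen 1) into AxisMirrorCeiling, MirrorDomination + glue SubOnsetTwoPointCeilingsGlue · direct attempts still welcome (low priority) · by planner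
why it might fail: it is the n = 2 hyperscaling (E0′-class) bound at weak coupling, unprinted in d = 4: a sub-onset resolution may sit in a crossover where |Cov| at lattice separation R exceeds C/R⁸ by factors not uniform in β.
sources: arXiv:1803.01950, Balaban1989CMP122, OsterwalderSeiler1978, OsterwalderSchrader1975
[crux] the n = 2 instance of the sub-onset ceilings (wuc): for SU(2)-class G, r, calibrating tests
(v; f,g,h) and Λ₅ there is ε₀ > 0 such that for every 0 < ε ≤ ε₀ carrying onset-floor data there are
C ≥ 0, ℓ₄ > 0, β₄ with: at every β ≥ β₄ and every resolution s ∈ (0,1] below the onset (no floors at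
any s' ∈ [2s,1]), on every odd torus with 4R+8 ≤ L, for plaquette fields of orientations q, q' at
sites cyclically (2R+4)-separated, 1 ≤ R, R s ≤ ℓ₄: |Cov_T(P_q(x), P_q'(y))| ≤ (C/R⁴)². Strictly
weaker than SubOnsetCeilings (stmt-QuantumFields-23313) and than the antecedent of
FactorialCalibration (both uniform in n). [difficulty: open-problem] -/
@[route_item "route-QuantumFields-SquareRootCeilings"]
def SubOnsetTwoPointCeilings : Prop :=
  open Literature.MathematicalPhysics.QuantumFieldTheory Literature.MathematicalPhysics.QuantumLattice Summit.QuantumFields.YangMills.Cruxes.OSLegsFromFemtoAndGap.DlrCollarTransfer in ∀ (G : Type) [Group G] [TopologicalSpace G] [IsTopologicalGroup G] [CompactSpace G], IsCompactSimpleLieGroup G → Nonempty (G ≃ₜ* Matrix.specialUnitaryGroup (Fin 2) ℂ) → letI : MeasurableSpace G := borel G; haveI : BorelSpace G := ⟨rfl⟩; ∀ (r : LatticeRep G) (v f g h : SchwartzMap (EuclideanSpace ℝ (Fin 4)) ℝ) (Λ₅ : ℝ), ∃ ε₀ : ℝ, 0 < ε₀ ∧ ∀ ε : ℝ, 0 <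 ε → ε ≤ ε₀ → (∃ β₅ : ℝ, ∀ β : ℝ, β₅ ≤ β → ∃ s : ℝ, 0 < s ∧ s ≤ 1 ∧ (∀ L : ℕ, Λ₅ ≤ s * L → ε ≤ Q2 G r β L s (thetaTest 4 v) v) ∧ (∀ L : ℕ, Λ₅ ≤ s * L → ε ≤ |Q3 G r β L s f g h|)) → ∃ (C ℓ₄ β₄ : ℝ), 0 < ℓ₄ ∧ 0 ≤ C ∧ ∀ β : ℝ, β₄ ≤ β → ∀ s : ℝ, 0 < s → s ≤ 1 → (∀ s' : ℝ, 2 * s ≤ s' → s' ≤ 1 → ¬ ((∀ L : ℕ, Λ₅ ≤ s' * L → ε ≤ Q2 G r β L s' (thetaTest 4 v) v) ∧ (∀ L : ℕ, Λ₅ ≤ s' * L → ε ≤ |Q3 G r β L s' f g h|))) → ∀ (L : ℕ) (q q' : Fin 4 × Fin 4) (x y : Fin 4 → ℤ) (R : ℕ), q.1 < q.2 → q'.1 < q'.2 → 1 ≤ R → (R : ℝ) * s ≤ ℓ₄ → 4 * R + 8 ≤ L → (∃ k : Fin 4, (2 * (R : ℤ) + 4) ≤ |((((x k - y k : ℤ)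 : ZMod (2 * L + 1))).valMinAbs : ℤ)|) → |torusE G r β L (fun U => (plane G r q x U - torusE G r β L (plane G r q x)) * (plane G r q' y U - torusE G r β L (plane G r q' y)))| ≤ (C / (R : ℝ) ^ 4) ^ 2

-- parent: SubOnsetTwoPointCeilings · child (gen 1)
/--     item stmt-QuantumFields-26791 · crux · rank 301 · open
    parent: SubOnsetTwoPointCeilings · by planner
    why it might fail: It is K1 on its extremal configurations (mirror pairs carry the maximal leading coefficient and are ≥ 0, so nothing cancels): the full two-point hyperscaling law below onset, unprinted for SU(2) in d = 4; a crossover factor growing in β at R ≍ ℓ₄/s would break the uniform C.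
    sources: OsterwalderSeiler1978, FILS1978, GlimmJaffe1987, arXiv:1803.01950, Balaban1989CMP122
[crux · wuc of K1 · rank 3] the two-point wall on its EXTREMAL one-parameter family only: same
orientation q, separation t·e_k purely along one lattice axis k, 2R+2 ≤ t ≤ L, below onset (R s ≤
ℓ₄, sub-onset prefix verbatim from SubOnsetTwoPointCeilings): |Cov_T(P_q(t e_k), P_q(0))| ≤ (C/R⁴)².
These are reflection (mirror) pairs: by site/link reflection positivity of the Wilson action
(Osterwalder–Seiler) they are ≥ 0 and t ↦ c_{q,k}(t) = ⟨A, T_k^t A⟩ is a torus-Hankel sequence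
(positive type, log-convex, decreasing up to t = L) of ONE centred plaquette vector A — so the n = 2
wall becomes a Hausdorff-moment ceiling on the spectral measure μ_A of a single plaquette (μ_A-mass
within energy η of the vacuum ≤ C′η⁸ for η above the femto energy s/ℓ₄); no sign cancellation is
available or needed, and monotonicity in t makes one separation per R enough. No summit is proved by
this item. -/
@[route_item "route-QuantumFields-SquareRootCeilings"]
def AxisMirrorCeiling : Prop :=
  open Literature.MathematicalPhysics.QuantumFieldTheory Literature.MathematicalPhysics.QuantumLattice Summit.QuantumFields.YangMills.Cruxes.OSLegsFromFemtoAndGap.DlrCollarTransfer in ∀ (G : Type) [Group G] [TopologicalSpace G] [IsTopologicalGroup G] [CompactSpace G], IsCompactSimpleLieGroup G → Nonempty (G ≃ₜ* Matrix.specialUnitaryGroup (Fin 2) ℂ) → letI : MeasurableSpace G := borel G; haveI : BorelSpace G := ⟨rfl⟩; ∀ (r : LatticeRep G) (v f g h : SchwartzMap (EuclideanSpace ℝ (Fin 4)) ℝ) (Λ₅ : ℝ), ∃ ε₀ : ℝ, 0 < ε₀ ∧ ∀ ε : ℝ, 0 < ε → ε ≤ ε₀ → (∃ β₅ : ℝ,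 ∀ β : ℝ, β₅ ≤ β → ∃ s : ℝ, 0 < s ∧ s ≤ 1 ∧ (∀ L : ℕ, Λ₅ ≤ s * L → ε ≤ Q2 G r β L s (thetaTest 4 v) v) ∧ (∀ L : ℕ, Λ₅ ≤ s * L → ε ≤ |Q3 G r β L s f g h|)) → ∃ (C ℓ₄ β₄ : ℝ), 0 < ℓ₄ ∧ 0 ≤ C ∧ ∀ β : ℝ, β₄ ≤ β → ∀ s : ℝ, 0 < s → s ≤ 1 → (∀ s' : ℝ, 2 * s ≤ s' → s' ≤ 1 → ¬ ((∀ L : ℕ, Λ₅ ≤ s' * L → ε ≤ Q2 G r β L s' (thetaTest 4 v) v) ∧ (∀ L : ℕ, Λ₅ ≤ s' * L → ε ≤ |Q3 G r β L s' f g h|))) → ∀ (L : ℕ) (q : Fin 4 × Fin 4) (k : Fin 4) (R t : ℕ), q.1 < q.2 → 1 ≤ R → (R : ℝ) * s ≤ ℓ₄ → 4 * R + 8 ≤ L → 2 * R + 2 ≤ t → t ≤ L → |torusE G r β L (fun U => (plane G r q (fun i => if i = k then (t : ℤ) else 0) U - torusE G r β L (plane G r q (fun i => if i = k then (t : ℤ)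 else 0))) * (plane G r q (fun _ => 0) U - torusE G r β L (plane G r q (fun _ => 0))))| ≤ (C / (R : ℝ) ^ 4) ^ 2

-- parent: SubOnsetTwoPointCeilings · child (gen 1)
/--     item stmt-QuantumFields-26792 · support · rank 302 · closed · proved by Summit.QuantumFields.YangMills.Theorems.MirrorDomination.squareRootCeilings_mirrorDomination_proof (prover)
    parent: SubOnsetTwoPointCeilings · by planner
    sources: OsterwalderSeiler1978, FILS1978, GlimmJaffe1987
[support · provable-grade · rank 9] RP mirror domination: for a pair (q,x),(q′,y) with |x_k −
y_k|_cyc ≥ 2R+4 reflect across the site (even gap) or link (odd gap) hyperplane orthogonal to e_k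
midway between them; reflection-positivity Cauchy–Schwarz (tree:
Cruxes.NT.ConjugateResponse.sq_le_sq_mul_mirrorCov_of_response, torusE_comp_cfgReflect; FILS 1978
Thm 2.1) gives |Cov_T(P_q(x),P_q′(y))|² ≤ c_{q,k}(d₁)·c_{q′,k}(d₂) with on-axis same-orientation
mirror separations d₁,d₂ ∈ [2R+3, L+1] (plaquettes containing e_k shift by one unit; separation L+1
≡ L on the odd torus), hence ≤ (C/R⁴)²·(C/R⁴)². Reflections in direction k ≠ 0 by conjugating Θ₀
with a coordinate permutation (torusE is hypercubic-invariant). Constants C ↦ C. -/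
@[route_item "route-QuantumFields-SquareRootCeilings"]
def MirrorDomination : Prop :=
  AxisMirrorCeiling → SubOnsetTwoPointCeilings

-- `MirrorDomination` holds: proved by `Summit.QuantumFields.YangMills.Theorems.MirrorDomination.squareRootCeilings_mirrorDomination_proof` (its module imports this route file, so no `_holds` link can be stated here).

-- parent: SubOnsetTwoPointCeilings · glue (gen 1)
/--     item stmt-QuantumFields-26793 · support · rank 303 · closed · proved by Summit.QuantumFields.YangMills.Theses.SquareRootCeilings.subOnsetTwoPointCeilingsGlue_proof (planner)
    parent: SubOnsetTwoPointCeilings · GLUE: children ⟹ parent · by planner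
AxisMirrorCeiling → MirrorDomination → SubOnsetTwoPointCeilings — modus ponens; the
reflection-positivity Cauchy–Schwarz content sits in MirrorDomination (provable-grade), the open
content in AxisMirrorCeiling (the two-point wall restricted to on-axis same-orientation mirror pairs
= a Hausdorff-moment ceiling on one plaquette's spectral measure). -/
@[route_item "route-QuantumFields-SquareRootCeilings"]
def SubOnsetTwoPointCeilingsGlue : Prop :=
  AxisMirrorCeiling → MirrorDomination → SubOnsetTwoPointCeilings

-- `SubOnsetTwoPointCeilingsGlue` holds: proved by `Summit.QuantumFields.YangMills.Theses.SquareRootCeilings.subOnsetTwoPointCeilingsGlue_proof` (its module imports this route file, so no `_holds` link can be stated here).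

/-- item stmt-QuantumFields-25892 · crux · rank 4 · open · by planner
why it might fail: it contains two- and three-point non-triviality for SU(2) (the ladder's NT residual): the rescaled truncated functions could vanish at every resolution (triviality scenario) or floors could hold only on L-dependent windows.
sources: arXiv:1803.01950, Balaban1989CMP122, OsterwalderSeiler1978
[crux] the onset-floor datum of route OnsetCalibration BY NAME (shared residual; landed
`OnsetCalibration.onsetFloors_of_NT : BalabanLadder.NT → OnsetFloors`): for SU(2) some LatticeRep
and tests (v; f,g,h pairwise disjoint supports) with ε > 0, Λ₅, β₅ such that every β ≥ β₅ has a
resolution s ∈ (0,1] carrying both floors on all odd tori with Λ₅ ≤ sL. [difficulty: open-problem] -/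
@[route_item "route-QuantumFields-SquareRootCeilings"]
def OnsetFloorsC : Prop :=
  Summit.QuantumFields.YangMills.Theses.OnsetCalibration.OnsetFloors

/-- item stmt-QuantumFields-26672 · support · rank 9 · closed · proved by Summit.QuantumFields.YangMills.Theses.SquareRootCeilings.dominationTransfer_proof (planner) · by planner
sources: OsterwalderSchrader1975
[support] K1 → K2 → the factorial-tolerant sub-onset ceilings, VERBATIM the antecedent of
`TypicalExteriorCeilings.FactorialCalibration`: take ε₀, C₁, ℓ₄, β₄ from K1 and C, θ, β₄' from K2
(β₄ := max); for n ≥ 2 put bᵢ := (C₁/R⁴)² (K1 on each separated pair), so |E∏| ≤ (C n^θ)ⁿ (C₁/R⁴)ⁿ =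
(C·C₁·n^θ/R⁴)ⁿ with κ := θ; n = 0 (empty product, 1 ≤ 1) and n = 1 (centred mean = 0, torus Gibbs
state a probability measure) are trivial. Pure algebra plus integral linearity; provable now.
[difficulty: provable-now] -/
@[route_item "route-QuantumFields-SquareRootCeilings"]
def DominationTransfer : Prop :=
  SubOnsetTwoPointCeilings → SqrtDomination → (open Literature.MathematicalPhysics.QuantumFieldTheory Literature.MathematicalPhysics.QuantumLattice Summit.QuantumFields.YangMills.Cruxes.OSLegsFromFemtoAndGap.DlrCollarTransfer in ∀ (G : Type) [Group G] [TopologicalSpace G] [IsTopologicalGroup G] [CompactSpace G], IsCompactSimpleLieGroup G → Nonempty (G ≃ₜ* Matrix.specialUnitaryGroup (Fin 2) ℂ) → letI : MeasurableSpace G := borel G; haveI : BorelSpace G := ⟨rfl⟩; ∀ (r : LatticeRep G) (v f g h : SchwartzMap (EuclideanSpace ℝ (Fin 4)) ℝ) (Λ₅ : ℝ), ∃ ε₀ : ℝ, 0 < ε₀ ∧ ∀ ε : ℝ, 0 < ε → ε ≤ ε₀ → (∃ β₅ : ℝ, ∀ β : ℝ, β₅ ≤ β → ∃ s : ℝ,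 0 < s ∧ s ≤ 1 ∧ (∀ L : ℕ, Λ₅ ≤ s * L → ε ≤ Q2 G r β L s (thetaTest 4 v) v) ∧ (∀ L : ℕ, Λ₅ ≤ s * L → ε ≤ |Q3 G r β L s f g h|)) → ∃ (C κ ℓ₄ β₄ : ℝ), 0 < ℓ₄ ∧ 0 ≤ C ∧ 0 ≤ κ ∧ ∀ β : ℝ, β₄ ≤ β → ∀ s : ℝ, 0 < s → s ≤ 1 → (∀ s' : ℝ, 2 * s ≤ s' → s' ≤ 1 → ¬ ((∀ L : ℕ, Λ₅ ≤ s' * L → ε ≤ Q2 G r β L s' (thetaTest 4 v) v) ∧ (∀ L : ℕ, Λ₅ ≤ s' * L → ε ≤ |Q3 G r β L s' f g h|))) → ∀ (L n : ℕ) (q : Fin n → Fin 4 × Fin 4) (x : Fin n → (Fin 4 → ℤ)) (R : ℕ), (∀ i, (q i).1 < (q i).2) → 1 ≤ R → (R : ℝ) * s ≤ ℓ₄ → 4 * R + 8 ≤ L → (∀ i j : Fin n, i ≠ j → ∃ k : Fin 4, (2 * (R : ℤ) + 4) ≤ |((((x i k - x j k : ℤ) : ZMod (2 * L + 1))).valMinAbs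 : ℤ)|) → |torusE G r β L (fun U => ∏ i, (plane G r (q i) (x i) U - torusE G r β L (plane G r (q i) (x i))))| ≤ (C * (n : ℝ) ^ κ / (R : ℝ) ^ 4) ^ n)

-- `DominationTransfer` holds: proved by `Summit.QuantumFields.YangMills.Theses.SquareRootCeilings.dominationTransfer_proof` (its module imports this route file, so no `_holds` link can be stated here).

/-- item stmt-QuantumFields-26673 · support · rank 9 · closed · proved by Summit.QuantumFields.YangMills.Theorems.SquareRootCeilings.factorialCalibrationC_proof (prover) · by planner
sources: OsterwalderSchrader1975, KravchukQiaoRychkov2021, GlimmJaffe1987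
[support] BY NAME the shared support `TypicalExteriorCeilings.FactorialCalibration`
(stmt-QuantumFields-25894): factorial-tolerant sub-onset ceilings → OnsetFloors → OnsetVanishes →
the leaf (the OnsetCalibration calibration `assembly_proof` re-run with the factorial-tolerant
infinite-volume engine `IVData_holds`, K ↦ C n^κ). [difficulty: L] -/
@[route_item "route-QuantumFields-SquareRootCeilings"]
def FactorialCalibrationC : Prop :=
  Summit.QuantumFields.YangMills.Theses.TypicalExteriorCeilings.FactorialCalibration

-- `FactorialCalibrationC` holds: proved by `Summit.QuantumFields.YangMills.Theorems.SquareRootCeilings.factorialCalibrationC_proof` (its module imports this route file, so no `_holds` link can be stated here).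

/-- item stmt-QuantumFields-26674 · assembly · rank 1 · closed · proved by Summit.QuantumFields.YangMills.Theses.SquareRootCeilings.assembly_proof (planner) · by planner
sources: OsterwalderSchrader1975, GlimmJaffe1987
[assembly] SqrtDomination → SubOnsetTwoPointCeilings → DominationTransfer → FactorialCalibration (by
name) → OnsetFloors (by name) → the leaf
`InfiniteVolumeContinuum.HypercubicOSDataFromInfiniteVolume`; provable now (uses the proved
OnsetVanishes). -/
@[route_item "route-QuantumFields-SquareRootCeilings"]
def Assembly : Prop :=
  SqrtDomination → SubOnsetTwoPointCeilings → DominationTransfer → FactorialCalibrationC → OnsetFloorsC → Summit.QuantumFields.YangMills.Theses.InfiniteVolumeContinuum.HypercubicOSDataFromInfiniteVolume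

-- `Assembly` holds: proved by `Summit.QuantumFields.YangMills.Theses.SquareRootCeilings.assembly_proof` (its module imports this route file, so no `_holds` link can be stated here).

/-! D-0027 §2.1 — DECIDING THEOREM (planner-authored via `route open/edit --closes-file`; by planner-ym-idea-11-g3-0 2026-08-28T07:36:04Z):
its hypotheses are this route's items and its conclusion the registered leaf `Summit.QuantumFields.YangMills.Theses.InfiniteVolumeContinuum.HypercubicOSDataFromInfiniteVolume` (rung R2a, D-0061) (glue_lint), and it elaborates with this file. -/

@[closes "route-QuantumFields-SquareRootCeilings"] theorem closes (hA : Assembly) (hD : SqrtDomination) (hT : SubOnsetTwoPointCeilings) (hX : DominationTransfer)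
    (hC : FactorialCalibrationC) (hF : OnsetFloorsC) :
    Summit.QuantumFields.YangMills.Theses.InfiniteVolumeContinuum.HypercubicOSDataFromInfiniteVolume :=
  hA hD hT hX hC hF

end Summit.QuantumFields.YangMills.Theses.SquareRootCeilings
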